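import Summits.CriticalPhenomena.PercolationContinuityZ3.Theorems.PercNearOneGluingNoHeavyQuantGateMoveBlobGiantData
import Summits.CriticalPhenomena.PercolationContinuityZ3.Theorems.PercNearOneGluingNoHeavyQuantWindowMix
import HarnessLib

/-!
# QUANT lane R8, T-DEC, leg (III): the E-branch of `LawDec.WindowMixDEC` (CW) in its own binder — **`windowMix_of_critE`**:
# criterion E of `ν` at the ONE layer `j` gives the conclusion of `WindowMixDEC` (no window, no top-affordability, any `a`, any `j`)

builds on p205010 (kernel theorem, internal audit signed; external expert review pending)

Support file (`--supports stmt-CriticalPhenomena-4575`), QUANT lane seat prim-quant-arm-1 (gen 40), rung R8 of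
`run/shared/lean/prim/quant/LADDER.md`.  One theorem, standard axioms, no sorries, no definitions.  Restates this seat's
`decAtT_gateMoveBlob_of_critE` (`…QuantGateMoveBlobGiantData`, conclusion law `slice ν a g + gz(δ₀ − δ_a)` at target `S + ag − zag`) in the
binder of lead g31's `@[conjecture] LawDec.WindowMixDEC` (`…QuantWindowMix`: conclusion law `(1−g)·ν + g·shiftBut ν a z` at target `S + ag(1−z)`),
through `windowMix_eq_slice_add`.  Reading: `WindowMixDEC` (= the window form CW of the blob step, statement of record for leg (III)) HOLDS at every
layer `j` at which the partner law `ν` satisfies criterion E for the target `S` — `y/(1−y)·ν{l ≤ j : 2l < S} ≤ ν{h > j}` — using that layer ALONE;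
the open part of `WindowMixDEC` is the branch in which `ν`'s layer-`j` datum needs credit pairs (there the window is necessary: census-2's `slCex`).

* **`LawDec.windowMix_of_critE`** — the statement above (hypotheses: `0 < y < 1`, `0 ≤ z ≤ ν 0`, `g ≤ 1`, `y ≤ (1−z)g`, `1 ≤ a`, `ν` a probability law
  on `{0..M}`, `0 < S`, criterion E at `(S, j)`; `S` need not be the mean and `y·M ≤ S`, `j < M + a` are not needed).

HONEST STATUS: `WindowMixDEC`, `WindowMixSingleLayer`, `GateMove`, `GatedConvEmptyFree`, `SingleGateConvClosed`, `TreeDEC`, `FarTreeRow` OPEN;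
RATE class log\* / honest sentence of `run/shared/lean/prim/quant/README.md` UNCHANGED.

[this work]; `WindowMixDEC` and `windowMix_eq_slice_add`: prim-quant-lead g31 (this lane).  Nothing here is cited as a published result.  The gluing
rows served [cite: KozmaNitzan2024, Conjecture 3 (p. 15)]; product measure [cite: Grimmett1999, §1.3 p. 10].
-/

noncomputable section

namespace Summit.CriticalPhenomena.PercolationContinuityZ3.Theorems

namespace Quant

open Finset

namespace LawDec

/-- **THE E-BRANCH OF `WindowMixDEC`.**  `0 < y < 1`, `0 ≤ z ≤ ν 0`, `g ≤ 1`, `y ≤ (1−z)g`, `1 ≤ a`; `ν ≥ 0` a probability law on `{0..M}`,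
`0 < S`; if `y/(1−y)·Σ_{l ≤ j, 2l < S} ν l ≤ Σ_{j < h ≤ M} ν h` (criterion E of `ν` at `(S, j)`) then
`DECAtT y (S + ag(1−z)) j (M + a) ((1−g)·ν + g·shiftBut ν a z)` — the conclusion of `LawDec.WindowMixDEC` at the layer `j`, from that layer alone.
(`decAtT_gateMoveBlob_of_critE` + `windowMix_eq_slice_add`.) [this work] -/
theorem windowMix_of_critE (y z g S : ℝ) (a j M : ℕ) (ν : ℕ → ℝ)
    (hy0 : 0 < y) (hy1 : y < 1) (hz0 : 0 ≤ z) (hzν : z ≤ ν 0) (hg1 : g ≤ 1) (hyg : y ≤ (1 - z) * g) (ha : 1 ≤ a)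
    (hν0 : ∀ h, 0 ≤ ν h) (hνM : ∀ h, M < h → ν h = 0) (hν1 : ∑ h ∈ Finset.range (M + 1), ν h = 1) (hS0 : 0 < S)
    (hE : y / (1 - y) * ∑ l ∈ Finset.range (j + 1), (if 2 * (l : ℝ) < S then ν l else 0)
      ≤ ∑ h ∈ Finset.Ico (j + 1) (M + 1), ν h) :
    DECAtT y (S + (a : ℝ) * g * (1 - z)) j (M + a) (fun h => (1 - g) * ν h + g * shiftBut ν a z h) := by
  have e : (fun h => (1 - g) * ν h + g * shiftBut ν a z h)
      = fun h => slice ν a g h + g * z * ((if h = 0 then (1 : ℝ) else 0) - (if h = a then (1 : ℝ) else 0)) :=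
    funext fun h => windowMix_eq_slice_add ν a g z h
  rw [e, show S + (a : ℝ) * g * (1 - z) = S + (a : ℝ) * g - z * (a : ℝ) * g by ring]
  exact decAtT_gateMoveBlob_of_critE y z g S a j M ν hy0 hy1 hz0 hg1 hyg ha hν0 hνM hν1 hS0 hzν hE

end LawDec

end Quant

end Summit.CriticalPhenomena.PercolationContinuityZ3.Theorems
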